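/-
Soloist artefact (solo-KontsevichZagierPeriods-informed, session s25): the EXTENSION MODEL `𝒟_d`.
References: A. Huber, G. Wüstholz, *Transcendence and linear relations of 1-periods*, Cambridge
Tracts in Math. 227 (2022), Def. 7.1, 7.6, Prop. 7.17, App. A.3; A. Huber, *Galois theory of
periods*, Münster J. Math. 13 (2020), §3–4; J. Ayoub, *Nouvelles cohomologies de Weil en
caractéristique positive*, Algebra Number Theory 14 (2020), Rem. 1.3 (density question).
-/
import Summits.KontsevichZagierPeriods.KontsevichZagierPeriods.Theorems.SoloInformedFormalPeriodRing

/-!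
# The extension model `𝒟_d` (Proposition VI-ter, part 1): objects, morphisms, formal periods

The diagonalizable models `𝒞_G` of `SoloInformedFormalPeriodModel` are semisimple: there the
failure of effective injectivity (Proposition VI, `SoloInformedEffectiveModel`) is carried by two
non-isomorphic *simple* effective objects that become isomorphic after one Lefschetz twist.  For
motives that failure mode is excluded (pure effective motives cancel `𝕃`).  The present model is
the smallest *non-semisimple* effective category exhibiting the failure mode that is NOT excluded:
an extension class that dies under twisting.

Fix `d : ℕ`.  An object of `𝒟_d` is an `ℕ`-graded finite basis `B` together with a matrix
`N : ℚ^B → ℚ^B` supported on `(degree d) → (degree 0)` ("extension data"); a morphism is a graded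
matrix commuting with `N`.  (`𝒟_d` is the category of finite-dimensional comodules of the
bialgebra `ℚ[t, ε]/(tε, ε²)`, `Δt = t ⊗ t`, `Δε = 1 ⊗ ε + ε ⊗ t^d` — the affine line with an
embedded infinitesimal point at `t = 0`; this description is motivation only and is not used.)
The fibre functor to `(ℚ, ℚ)-Vect` is `X ↦ (ℚ^B, ℚ^B, diag(c^{deg}))` as for `𝒞_ℕ`.

Main definitions and results of this file:
* `SoloInformedExtObj d`, `EHom`, the split objects `ofGr`, the lines `lineE n`, the
  Kummer-type object `kummer d` (basis `e₀` in degree `0`, `e_d` in degree `d`, `N e_d = e₀`),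
  the tensor product `tensorE` (`N_{X ⊗ Y} = N_X ⊗ pr₀ + pr₀ ⊗ N_Y`);
* the space of formal periods `EFP d = P̃(𝒟_d)` built VERBATIM from [HW22, Def. 7.6]
  (symbols `(X, σ, ω)`, bilinearity, functoriality in `EHom`), classes `clsE`, the generators
  `genE n = ⟦(𝟙_n, 1, 1)⟧` and the EXTENSION PERIOD `eta = ⟦(K, e_d, e₀^∨)⟧`;
* the structure lemma `clsE_eq_sum` (for `d ≠ 0`):
  `⟦(X, σ, ω)⟧ = ∑_b σ_b ω_b · p_{deg b} + (ωᵀ N_X σ) · η`.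
The identification `P̃(𝒟_d) ≅ ℚ[t] ⋉ ℚ·η` (trivial square-zero extension), the ring structure and
the period-conjecture statements are in `SoloInformedExtensionPeriods`.
-/

noncomputable section

open scoped BigOperators

namespace Summit.KontsevichZagierPeriods.KontsevichZagierPeriods.Theorems

open SoloInformedGrObj

/-- An object of `𝒟_d`: an `ℕ`-graded finite basis with extension data `N` supported on
`(degree d) → (degree 0)`. -/
structure SoloInformedExtObj (d : ℕ) where
  /-- the underlying graded object -/
  gr : SoloInformedGrObj ℕ
  /-- the extension matrix `N` (row `b`, column `b'`) -/
  nmat : gr.B → gr.B → ℚ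
  /-- support: `N_{b b'} ≠ 0` only from degree `d` (column) to degree `0` (row) -/
  nsupp : ∀ b b', nmat b b' ≠ 0 → gr.deg b = 0 ∧ gr.deg b' = d

namespace SoloInformedExtObj

variable {d : ℕ}

/-- Rows of `N` outside degree `0` vanish. -/
theorem nmat_eq_zero_of_row (X : SoloInformedExtObj d) {b b' : X.gr.B} (h : X.gr.deg b ≠ 0) :
    X.nmat b b' = 0 := by
  by_contra hne
  exact h (X.nsupp b b' hne).1

/-- Columns of `N` outside degree `d` vanish. -/
theorem nmat_eq_zero_of_col (X : SoloInformedExtObj d) {b b' : X.gr.B} (h : X.gr.deg b' ≠ d) :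
    X.nmat b b' = 0 := by
  by_contra hne
  exact h (X.nsupp b b' hne).2

/-- `N² = 0` (for `d ≠ 0`): a column index of degree `d` is never a row index of degree `0`. -/
theorem nmat_mul_nmat [NeZero d] (X : SoloInformedExtObj d) (b b'' : X.gr.B) :
    ∑ b', X.nmat b b' * X.nmat b' b'' = 0 := by
  refine Finset.sum_eq_zero fun b' _ => ?_
  by_cases h : X.gr.deg b' = 0
  · have h' : X.gr.deg b' ≠ d := by rw [h]; exact (NeZero.ne d).symm
    rw [X.nmat_eq_zero_of_col h', zero_mul]
  · rw [X.nmat_eq_zero_of_row h, mul_zero]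

/-- Morphisms of `𝒟_d`: graded matrices commuting with the extension data, `f N_X = N_Y f`. -/
structure EHom (X Y : SoloInformedExtObj d) where
  /-- the underlying graded matrix -/
  f : Hom X.gr Y.gr
  /-- `(f N_X)_{y x} = (N_Y f)_{y x}` -/
  comm : ∀ y x, ∑ x', f.mat y x' * X.nmat x' x = ∑ y', Y.nmat y y' * f.mat y' x

/-! ### Objects: split objects, lines, the Kummer object, tensor products -/

/-- Split objects: a graded object with `N = 0` (the semisimple objects of `𝒟_d`). -/
@[reducible] def ofGr (X : SoloInformedGrObj ℕ) : SoloInformedExtObj d where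
  gr := X
  nmat _ _ := 0
  nsupp _ _ h := (h rfl).elim

/-- The line `𝟙_n` of `𝒟_d` (one basis vector in degree `n`, `N = 0`); `𝕃 = 𝟙_1`. -/
@[reducible] def lineE (n : ℕ) : SoloInformedExtObj d := ofGr (line n)

/-- The Kummer-type object `K`: basis `false ↦ e₀` (degree `0`), `true ↦ e_d` (degree `d`),
`N e_d = e₀`: a non-split extension of `𝟙_d` by `𝟙_0`. -/
@[reducible] def kummer (d : ℕ) : SoloInformedExtObj d where
  gr := { B := Bool, deg := fun k => if k then d else 0 }
  nmat k k' := if k = false ∧ k' = true then 1 else 0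
  nsupp k k' h := by
    by_cases hk : k = false ∧ k' = true
    · obtain ⟨rfl, rfl⟩ := hk; simp
    · simp [hk] at h

/-- The vector `e_d ∈ V(K)` (as a coordinate function) — also the covector `e_d^∨`. -/
def kTop : (kummer d).gr.B → ℚ := fun k => if k then 1 else 0

/-- The covector `e₀^∨ ∈ V(K)^∨`. -/
def kBot : (kummer d).gr.B → ℚ := fun k => if k then 0 else 1

/-- The matrix of `pr₀`, the projection onto the degree-`0` part of a graded object. -/
def pr0 (X : SoloInformedGrObj ℕ) (x x' : X.B) : ℚ :=
  if x = x' then (if X.deg x = 0 then 1 else 0) else 0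

/-- Tensor product in `𝒟_d`: bases multiply, degrees add, and
`N_{X ⊗ Y} = N_X ⊗ pr₀^Y + pr₀^X ⊗ N_Y` (`pr₀` = projection onto degree `0`). -/
def tensorE (X Y : SoloInformedExtObj d) : SoloInformedExtObj d where
  gr := tensor X.gr Y.gr
  nmat p q := X.nmat p.1 q.1 * pr0 Y.gr p.2 q.2 + pr0 X.gr p.1 q.1 * Y.nmat p.2 q.2
  nsupp p q h := by
    obtain ⟨x, y⟩ := p
    obtain ⟨x', y'⟩ := q
    by_contra hdeg
    apply h
    have h1 : X.nmat x x' * pr0 Y.gr y y' = 0 := by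
      by_cases hn : X.nmat x x' = 0
      · rw [hn, zero_mul]
      by_cases hc : y = y'
      · by_cases hy : Y.gr.deg y = 0
        · exfalso; apply hdeg
          obtain ⟨hx, hx'⟩ := X.nsupp x x' hn
          subst hc
          exact ⟨by simp [hx, hy], by simp [hx', hy]⟩
        · simp [pr0, hy]
      · simp [pr0, hc]
    have h2 : pr0 X.gr x x' * Y.nmat y y' = 0 := by
      by_cases hn : Y.nmat y y' = 0
      · rw [hn, mul_zero]
      by_cases hc : x = x'
      · by_cases hx : X.gr.deg x = 0
        · exfalso; apply hdeg
          obtain ⟨hy, hy'⟩ := Y.nsupp y y' hn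
          subst hc
          exact ⟨by simp [hx, hy], by simp [hx, hy']⟩
        · simp [pr0, hx]
      · simp [pr0, hc]
    simp only at h1 h2 ⊢
    rw [h1, h2, add_zero]

/-- Twisting by a line of POSITIVE degree kills all extension data:
`N_{X ⊗ 𝟙_n} = 0` for `n ≠ 0`. -/
theorem tensorE_lineE_nmat (X : SoloInformedExtObj d) {n : ℕ} (hn : n ≠ 0)
    (p q : (tensorE X (lineE n)).gr.B) : (tensorE X (lineE n)).nmat p q = 0 := by
  simp [tensorE, pr0, lineE, ofGr, line, hn]

/-! ### Symbols, relations, formal periods [HW22, Def. 7.6] -/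

/-- Symbols `(X, σ, ω)` of `𝒟_d`. -/
def SymE (d : ℕ) : Type 1 := Σ X : SoloInformedExtObj d, (X.gr.B → ℚ) × (X.gr.B → ℚ)

/-- The symbol `(X, σ, ω)`. -/
def mkSymE (X : SoloInformedExtObj d) (σ ω : X.gr.B → ℚ) : SymE d := ⟨X, (σ, ω)⟩

/-- The free `ℚ`-module on symbols. -/
abbrev FreeE (d : ℕ) : Type 1 := SymE d →₀ ℚ

/-- The generator attached to a symbol. -/
def fsymE (X : SoloInformedExtObj d) (σ ω : X.gr.B → ℚ) : FreeE d :=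
  Finsupp.single (mkSymE X σ ω) 1

/-- The relations of [HW22, Def. 7.6] for `𝒟_d`: bilinearity and functoriality IN `EHom`. -/
def relSetE (d : ℕ) : Set (FreeE d) :=
  {v | ∃ (X : SoloInformedExtObj d) (σ₁ σ₂ ω : X.gr.B → ℚ),
      v = fsymE X (σ₁ + σ₂) ω - fsymE X σ₁ ω - fsymE X σ₂ ω} ∪
  {v | ∃ (X : SoloInformedExtObj d) (a : ℚ) (σ ω : X.gr.B → ℚ),
      v = fsymE X (a • σ) ω - a • fsymE X σ ω} ∪
  {v | ∃ (X : SoloInformedExtObj d) (σ ω₁ ω₂ : X.gr.B → ℚ),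
      v = fsymE X σ (ω₁ + ω₂) - fsymE X σ ω₁ - fsymE X σ ω₂} ∪
  {v | ∃ (X : SoloInformedExtObj d) (a : ℚ) (σ ω : X.gr.B → ℚ),
      v = fsymE X σ (a • ω) - a • fsymE X σ ω} ∪
  {v | ∃ (X Y : SoloInformedExtObj d) (g : EHom X Y) (σ : X.gr.B → ℚ) (ω : Y.gr.B → ℚ),
      v = fsymE X σ (g.f.pull ω) - fsymE Y (g.f.push σ) ω}

/-- The submodule of relations. -/
def RelE (d : ℕ) : Submodule ℚ (FreeE d) := Submodule.span ℚ (relSetE d)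

/-- The space of formal periods `P̃(𝒟_d)`. -/
abbrev EFP (d : ℕ) : Type 1 := FreeE d ⧸ RelE d

/-- The class `⟦(X, σ, ω)⟧`. -/
def clsE (X : SoloInformedExtObj d) (σ ω : X.gr.B → ℚ) : EFP d :=
  Submodule.Quotient.mk (fsymE X σ ω)

/-- A relation vanishes in the quotient. -/
theorem mk_eq_zero_of_mem_relSetE {v : FreeE d} (h : v ∈ relSetE d) :
    (Submodule.Quotient.mk v : EFP d) = 0 :=
  (Submodule.Quotient.mk_eq_zero _).2 (Submodule.subset_span h)

/-- Additivity in `σ`. -/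
theorem clsE_add_left (X : SoloInformedExtObj d) (σ₁ σ₂ ω : X.gr.B → ℚ) :
    clsE X (σ₁ + σ₂) ω = clsE X σ₁ ω + clsE X σ₂ ω := by
  have h := mk_eq_zero_of_mem_relSetE (d := d)
    (Or.inl (Or.inl (Or.inl (Or.inl ⟨X, σ₁, σ₂, ω, rfl⟩))))
  simp only [Submodule.Quotient.mk_sub] at h
  rw [sub_sub] at h
  exact sub_eq_zero.1 h

/-- Homogeneity in `σ`. -/
theorem clsE_smul_left (X : SoloInformedExtObj d) (a : ℚ) (σ ω : X.gr.B → ℚ) :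
    clsE X (a • σ) ω = a • clsE X σ ω := by
  have h := mk_eq_zero_of_mem_relSetE (d := d)
    (Or.inl (Or.inl (Or.inl (Or.inr ⟨X, a, σ, ω, rfl⟩))))
  simp only [Submodule.Quotient.mk_sub, Submodule.Quotient.mk_smul] at h
  exact sub_eq_zero.1 h

/-- Additivity in `ω`. -/
theorem clsE_add_right (X : SoloInformedExtObj d) (σ ω₁ ω₂ : X.gr.B → ℚ) :
    clsE X σ (ω₁ + ω₂) = clsE X σ ω₁ + clsE X σ ω₂ := by
  have h := mk_eq_zero_of_mem_relSetE (d := d) (Or.inl (Or.inl (Or.inr ⟨X, σ, ω₁, ω₂, rfl⟩)))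
  simp only [Submodule.Quotient.mk_sub] at h
  rw [sub_sub] at h
  exact sub_eq_zero.1 h

/-- Homogeneity in `ω`. -/
theorem clsE_smul_right (X : SoloInformedExtObj d) (a : ℚ) (σ ω : X.gr.B → ℚ) :
    clsE X σ (a • ω) = a • clsE X σ ω := by
  have h := mk_eq_zero_of_mem_relSetE (d := d) (Or.inl (Or.inr ⟨X, a, σ, ω, rfl⟩))
  simp only [Submodule.Quotient.mk_sub, Submodule.Quotient.mk_smul] at h
  exact sub_eq_zero.1 h

/-- FUNCTORIALITY in `EHom`: `⟦(X, σ, g^*ω)⟧ = ⟦(Y, g_*σ, ω)⟧`. -/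
theorem clsE_functorial {X Y : SoloInformedExtObj d} (g : EHom X Y) (σ : X.gr.B → ℚ)
    (ω : Y.gr.B → ℚ) : clsE X σ (g.f.pull ω) = clsE Y (g.f.push σ) ω := by
  have h := mk_eq_zero_of_mem_relSetE (d := d) (Or.inr ⟨X, Y, g, σ, ω, rfl⟩)
  simp only [Submodule.Quotient.mk_sub] at h
  exact sub_eq_zero.1 h

/-- `σ ↦ ⟦(X, σ, ω)⟧` is linear. -/
def clsELeft (X : SoloInformedExtObj d) (ω : X.gr.B → ℚ) : (X.gr.B → ℚ) →ₗ[ℚ] EFP d where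
  toFun σ := clsE X σ ω
  map_add' σ₁ σ₂ := clsE_add_left X σ₁ σ₂ ω
  map_smul' a σ := clsE_smul_left X a σ ω

/-- `ω ↦ ⟦(X, σ, ω)⟧` is linear. -/
def clsERight (X : SoloInformedExtObj d) (σ : X.gr.B → ℚ) : (X.gr.B → ℚ) →ₗ[ℚ] EFP d where
  toFun ω := clsE X σ ω
  map_add' ω₁ ω₂ := clsE_add_right X σ ω₁ ω₂
  map_smul' a ω := clsE_smul_right X a σ ω

/-- The line generators `p_n = ⟦(𝟙_n, 1, 1)⟧` (`per = p_1`). -/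
def genE (n : ℕ) : EFP d := clsE (lineE n) (fun _ => 1) (fun _ => 1)

/-- THE EXTENSION PERIOD `η = ⟦(K, e_d, e₀^∨)⟧`: "the integral of the degree-`0` coframe over
the degree-`d` frame of the Kummer object" (the analogue of `log α`). -/
def eta : EFP d := clsE (kummer d) kTop kBot

/-- The extension coefficient `ωᵀ N_X σ` of a symbol. -/
def etaCoef (X : SoloInformedExtObj d) (σ ω : X.gr.B → ℚ) : ℚ :=
  ∑ b, ∑ x, ω x * X.nmat x b * σ b

/-! ### Test morphisms and the structure lemma -/

/-- For a basis vector `b` of degree `≠ d`, the line inclusion `𝟙_{deg b} ⟶ X` is in `EHom`. -/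
def inclE (X : SoloInformedExtObj d) (b : X.gr.B) (hb : X.gr.deg b ≠ d) :
    EHom (lineE (X.gr.deg b)) X where
  f := lineIncl X.gr b
  comm y u := by
    have h0 : X.nmat y b = 0 := X.nmat_eq_zero_of_col hb
    simp [lineIncl, lineE, ofGr, line, h0]

/-- For a basis vector `b` of degree `d`, the test morphism `K ⟶ X`, `e_d ↦ e_b`,
`e₀ ↦ N e_b` is in `EHom` (uses `N² = 0`, i.e. `d ≠ 0`). -/
def kummerHom [NeZero d] (X : SoloInformedExtObj d) (b : X.gr.B) (hb : X.gr.deg b = d) :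
    EHom (kummer d) X where
  f :=
    { mat := fun x k => if k then (if x = b then 1 else 0) else X.nmat x b
      graded := fun x k h => by
        cases k
        · have hx : X.gr.deg x ≠ 0 := by simpa [kummer] using h
          simp [X.nmat_eq_zero_of_row hx]
        · have hx : x ≠ b := by
            rintro rfl; simp [hb] at h
          simp [hx] }
  comm y k := by
    cases k
    · simp [kummer, nmat_mul_nmat]
    · simp [kummer, Finset.sum_ite_eq']

/-- The projection `K ⟶ 𝟙_d` (quotient by the subobject `𝟙_0`) is in `EHom`. -/
def kummerPr : EHom (kummer d) (lineE d) where
  f :=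
    { mat := fun _ k => if k then 1 else 0
      graded := fun u k h => by
        cases k
        · simp
        · simp at h }
  comm u k := by
    cases k <;> simp [kummer, lineE, ofGr, line]

/-- `⟦(K, e_d, e_d^∨)⟧ = p_d` (via the projection `K ⟶ 𝟙_d`). -/
theorem clsE_kummer_top : clsE (kummer d) kTop kTop = genE d := by
  have hpull : (kummerPr (d := d)).f.pull (fun _ => 1) = kTop := by
    funext k; cases k <;> simp [Hom.pull, kummerPr, kTop]
  have hpush : (kummerPr (d := d)).f.push kTop = fun _ => 1 := by
    funext u; simp [Hom.push, kummerPr, kTop]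
  have h := clsE_functorial (kummerPr (d := d)) kTop (fun _ => 1)
  rw [hpull, hpush] at h
  exact h

/-- Basis vector of degree `≠ d`: `⟦(X, e_b, ω)⟧ = ω_b p_{deg b}`. -/
theorem clsE_single_of_ne (X : SoloInformedExtObj d) (b : X.gr.B) (hb : X.gr.deg b ≠ d)
    (ω : X.gr.B → ℚ) : clsE X (Pi.single b 1) ω = ω b • genE (X.gr.deg b) := by
  have h := clsE_functorial (inclE X b hb) (fun _ => 1) ω
  rw [show (inclE X b hb).f = lineIncl X.gr b from rfl, lineIncl_push, lineIncl_pull] at h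
  rw [← h, show (fun _ : (lineE (d := d) (X.gr.deg b)).gr.B => ω b) = ω b • (fun _ => (1 : ℚ))
    from by funext u; simp, clsE_smul_right]
  rfl

/-- Basis vector of degree `d`: `⟦(X, e_b, ω)⟧ = ω_b p_d + (∑_x ω_x N_{x b}) η`. -/
theorem clsE_single_of_eq [NeZero d] (X : SoloInformedExtObj d) (b : X.gr.B)
    (hb : X.gr.deg b = d) (ω : X.gr.B → ℚ) :
    clsE X (Pi.single b 1) ω = ω b • genE d + (∑ x, ω x * X.nmat x b) • eta := by
  have hpush : (kummerHom X b hb).f.push kTop = Pi.single b 1 := by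
    funext x
    by_cases hx : x = b
    · subst hx; simp [Hom.push, kummerHom, kTop]
    · simp [Hom.push, kummerHom, kTop, hx]
  have hpull : (kummerHom X b hb).f.pull ω = ω b • kTop + (∑ x, ω x * X.nmat x b) • kBot := by
    funext k
    cases k
    · simp [Hom.pull, kummerHom, kTop, kBot, mul_comm]
    · simp [Hom.pull, kummerHom, kTop, kBot, Finset.sum_ite_eq', mul_comm]
  rw [← hpush, ← clsE_functorial, hpull]
  change clsERight (kummer d) kTop _ = _
  rw [map_add, map_smul, map_smul]
  change ω b • clsE (kummer d) kTop kTop + _ • clsE (kummer d) kTop kBot = _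
  rw [clsE_kummer_top]
  rfl

/-- Any basis vector: `⟦(X, e_b, ω)⟧ = ω_b p_{deg b} + (∑_x ω_x N_{x b}) η`. -/
theorem clsE_single [NeZero d] (X : SoloInformedExtObj d) (b : X.gr.B) (ω : X.gr.B → ℚ) :
    clsE X (Pi.single b 1) ω = ω b • genE (X.gr.deg b) + (∑ x, ω x * X.nmat x b) • eta := by
  by_cases hb : X.gr.deg b = d
  · rw [clsE_single_of_eq X b hb, hb]
  · rw [clsE_single_of_ne X b hb]
    have h0 : ∑ x, ω x * X.nmat x b = 0 :=
      Finset.sum_eq_zero fun x _ => by rw [X.nmat_eq_zero_of_col hb, mul_zero]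
    rw [h0, zero_smul, add_zero]

/-- STRUCTURE LEMMA: `⟦(X, σ, ω)⟧ = ∑_b σ_b ω_b p_{deg b} + (ωᵀ N_X σ) η`. -/
theorem clsE_eq_sum [NeZero d] (X : SoloInformedExtObj d) (σ ω : X.gr.B → ℚ) :
    clsE X σ ω = ∑ b, (σ b * ω b) • genE (X.gr.deg b) + etaCoef X σ ω • eta := by
  have hσ : σ = ∑ b, σ b • (Pi.single b (1 : ℚ) : X.gr.B → ℚ) := by
    funext x
    simp [Finset.sum_apply, Pi.single_apply]
  have h1 : clsE X σ ω = clsELeft X ω (∑ b, σ b • (Pi.single b (1 : ℚ) : X.gr.B → ℚ)) := by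
    rw [← hσ]; rfl
  rw [h1, map_sum]
  simp only [map_smul]
  change ∑ b, σ b • clsE X (Pi.single b 1) ω = _
  simp only [clsE_single, smul_add, smul_smul, Finset.sum_add_distrib, etaCoef, Finset.sum_smul]
  congr 1
  refine Finset.sum_congr rfl fun b _ => ?_
  rw [Finset.smul_sum]
  refine Finset.sum_congr rfl fun x _ => ?_
  rw [smul_smul]
  congr 1
  ring

/-- In particular `P̃(𝒟_d)` is spanned by the `p_n` and `η`. -/
theorem clsE_mem_span [NeZero d] (X : SoloInformedExtObj d) (σ ω : X.gr.B → ℚ) :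
    clsE X σ ω ∈ Submodule.span ℚ (Set.range (genE (d := d)) ∪ {eta}) := by
  rw [clsE_eq_sum]
  refine Submodule.add_mem _ (Submodule.sum_mem _ fun b _ => Submodule.smul_mem _ _ ?_)
    (Submodule.smul_mem _ _ ?_)
  · exact Submodule.subset_span (Or.inl ⟨_, rfl⟩)
  · exact Submodule.subset_span (Or.inr rfl)

end SoloInformedExtObj

end Summit.KontsevichZagierPeriods.KontsevichZagierPeriods.Theorems
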